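import Literature.MathematicalPhysics.QuantumFieldTheory.Balaban1983to89.B3GkZeroLattice

/-!
# `Balaban1983to89.B3DeltaGkZeroLattice` — T. Bałaban, *(Higgs)₂,₃ quantum fields in a finite volume. III. Renormalization*,
# Commun. Math. Phys. **88** (1983) 411–445 [Balaban1983Higgs3], (2.5) p. 424 for the p. 433 pair `(□, ηℤ^{d+1})`: the SIX
# KERNEL CLAUSES of `δG_k(□, ηℤ^{d+1}, 0) = G_k(□,0) − G_k(0)|_□` — value, lattice derivative in either variable, Hölder
# quotients of these, mixed second difference — each `≤ C·e^{−δ₀r}·e^{−δ₀η|x−x′|_∞}` at fine points of DEPTH `r ≥ 3` in `□`,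
# REGULAR ON THE DIAGONAL, uniformly in the scale `k ≥ 1`, the box and the window (file 2 of 3 of the zero-field instance
# «`G_k(□,0) = G_k(0) + δG_k(□,ηZ^d,0)`, δG_k treated as an external scalar field»)

statement-level skeleton of published theorems with citation tags; proofs where landed; nothing here is a claim about the Yang–Mills mass gap

PDF held: `paper:balaban1983-higgs-2-3-quantum-fields-finite-volume` (journal page = PDF page + 410); p. 414 [PDF 4], p. 424 [PDF 14]
((2.5)), p. 433 [PDF 23] read in the OCR text (`p0004.txt`, `p0014.txt`, `p0023.txt`); [B4] = [Balaban1983RegularityDecay] p. 573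
(1.11)–(1.12), p. 581 (Cor. 2.3, last sentence) as quoted in `B3DeltaGkZeroNest`.

CITATION HEADER (lean-in-tree rule).  Part of the lit-balaban TYPED SKELETON (HOME `run/shared/lean/pub/lit-balaban/`), Phase 2:
SKELETON rows **B3.Eq2.5** (decl of record `B3Sect2StatementsPart2.ScaledKernels.Ineq25`, fold owner r15) and **B3.Txt@433**;
file 2 of 3 of the member «MODEL INSTANCE `A = B̃ = 0`, THE PAIR `(□, ηℤ^{d+1})`» (file 1 `B3GkZeroLattice`: the infinite-volume
propagator `G_k(0) = GkLat` as the limit of the cube propagators `gcube`; file 3 `B3Ineq25ZeroLattice`: the two-variable norm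
(1.32) of `h δG_k h′` and `Ineq25` for the concrete carrier); companion of `B3DeltaGkZeroNest` (the nested-box pair `□ ⊂ □₀`,
gen 6) whose six clauses, applied to the pairs `□ ⊂ C_t` and passed to the limit `t → ∞`, ARE the proof.

WHAT IS PRINTED.  p. 433 [PDF 23]: *"Finally we replace the scalar field propagator G_k(□,0) by G_k(0), i.e. we substitute
G_k(□,0) = G_k(0) + δG_k(□,ηZ^d,0) and we treat δG_k as an external scalar field."* (here `□` is the cube of size `3r(L^kε)`
of p. 433 and the localizations sit in the concentric cube `□₁` of size `r(L^kε)`, i.e. at distance `≥ r(L^kε)` from `∂□`);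
p. 424 [PDF 14], (2.5): *"In the estimates we treat them as external fields and we use the inequalities:
‖h(an operator δG_k(Ω,Ω₂,B̃) or (1.16))h′‖_{1,α} ≤ O(e^{−δ₀dist(Ω₂,∂Ω)} or (e(L^kε)p(L^kε))^{n+n′})e^{−δ₀dist(supp h,supp h′)},
(2.5) where h, h′ are functions giving the localizations of the vertices."*; [B4] p. 581: *"The same inequalities hold for
δG_k(Ω,Ω₀,A) with the additional factor e^{−δ₀(dist(supp f,Ω^c) + dist(supp f′,Ω^c))}."*

WHAT IS REPRODUCED (kind «model-instance», G.1 of `HOME/PHASE2-TARGETS.md`), counting normalisation of the zero-field box lineage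
(`n = L^k = η^{−1}`, `G_k(□,0) = Gfine ℓ k M k a m2 = (boxOpR n a_k m² M)⁻¹` on the fine box `Π[0,nM)`, `G_k(0) = B3GkZeroLattice.GkLat`):
* §1 the nesting `□ ⊂ C_t` of the box into the exhausting cubes (`fits_box`, offset `t·1`; `emb_box` = the centring shift),
  the DEPTH `Depth n M r x` of a fine point of `□` (`r ≤ blk x_i ≤ M_i − 1 − r`: its unit cube is at label sup-distance `≥ r+1` from
  `ηℤ^{d+1}∖□`) and `margin_of_depth`: depth `r` IS gen-6's label margin `r` for every nesting `□ ⊂ C_t`;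
* §2 the kernel `dGkLat ℓ k M a m2 x x′ = G_k(□,0)(x,x′) − G_k(0)(x,x′)` (matrix units; physical kernel `η^{−(d+1)}·dGkLat`),
  symmetric, and `dGk_box_eq`: gen-6's `dGk` for `□ ⊂ C_t` equals `g_t − G_k(□,0)`, so `δG_k(□,ηℤ^{d+1},0) = −lim_t δG_k(C_t,□,0)`;
* §3 THE SIX KERNEL CLAUSES, each `∃ δ₀ C > 0 ∀ k ≥ 1, window, box □ (M_i ≥ 1), r ≥ 3, points of depth r`:
  **`abs_dGkLat_le`** (value), **`abs_dGkLatDiff_le`** / **`abs_dGkLatDiff'_le`** (row / column derivative),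
  **`abs_dGkLatDD_le`** / **`abs_dGkLatDD'_le`** (Hölder quotient of the row derivative in the row variable / of the column
  derivative in the column variable, per `0 ≤ α < 1`), **`abs_dGkLatMixed_le`** (mixed second difference) — each from the gen-6
  clause of the same name for the pair `□ ⊂ C_t`, uniform in `t ≥ Σ_iM_i`, and `B3GkZeroLattice.tendsto_gcube`;
* §4 a non-vacuity witness (points of depth `3` exist; the value clause at `d + 1 = 3`, `L = 2`, `k = 1`).

HONEST SCOPE / DECLARED DIVERGENCES (F7).  (i) Only `A = B̃ = 0` (`U ≡ 1`, one component) — the printed case at this point of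
p. 433 (after the gauge step) —, `□ = Π[0,M)` a block-aligned rectangular parallelepiped of unit blocks with Neumann conditions
(the print's `□` is a cube), all `k ≥ 1`, running constants in a window `[a₋,a₊] × [0,m²₊]`; the (1.16) alternative of (2.5) is
not treated (at `Ã = 0` it vanishes).  (ii) Points: fine points of `□` of depth `r ≥ 3`; derivatives = forward differences along
bonds of `□`.  (iii) Sup norm for distances, lattice units `× η`.  (iv) Constants existential (on `d`, `L`, the window, and `α`
for the Hölder clauses).  (v) READING (as gen 6, GAPS G-B3-14 owner-accepted): the first factor of (2.5) is printed
`e^{−δ₀dist(Ω₂,∂Ω)}`; what [B4] (1.12)/Cor. 2.3 control and what is proved is the depth `r` of the LOCALIZATIONS inside `□`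
(= the print's `r(L^kε)` for `□₁ ⊂ □` on p. 433).  (vi) This file does not yet speak about `‖·‖_{1,α}` or the carrier
`ScaledKernels` (file 3).  (vii) ROUTE: gen-6's six nested-box clauses (`B3DeltaGkZeroNest`, themselves the print's «follows
easily from the properties of the propagators G_k(Ω,A) proved in the next paper») for `□ ⊂ C_t` + the limit `t → ∞` of file 1;
used BY NAME; plain `def`s + theorems, no `structure`, no Literature fact minted; standard axioms.  Value = kernel certificate of
the located p. 433 step for the zero-field instance, NOT summit progress.
Unit `lit-balaban-p03` (Phase-2 proof seat p03, gen 8); HOME `run/shared/lean/pub/lit-balaban/` (rows B3.Eq2.5 / B3.Txt@433).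
-/

namespace Literature.MathematicalPhysics.QuantumFieldTheory.Balaban1983to89.B3DeltaGkZeroLattice

open Finset Matrix Filter Topology
open Literature.MathematicalPhysics.QuantumFieldTheory.Balaban1983to89.B4ContourShift (supNorm supNorm_nonneg
  abs_le_supNorm exists_supNorm_eq)
open Literature.MathematicalPhysics.QuantumFieldTheory.Balaban1983to89.B4TwoRegion120 (supNorm_sub_comm)
open Literature.MathematicalPhysics.QuantumFieldTheory.Balaban1983to89.B4Reflection242
open Literature.MathematicalPhysics.QuantumFieldTheory.Balaban1983to89.B4BoxCov237
open Literature.MathematicalPhysics.QuantumFieldTheory.Balaban1983to89.B4TwoBox120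
open Literature.MathematicalPhysics.QuantumFieldTheory.Balaban1983to89.B4Thm110ZeroBox
open Literature.MathematicalPhysics.QuantumFieldTheory.Balaban1983to89.B3GkZeroBoxSeparated
open Literature.MathematicalPhysics.QuantumFieldTheory.Balaban1983to89.B3DeltaGkZeroNest
open Literature.MathematicalPhysics.QuantumFieldTheory.Balaban1983to89.B3GkZeroLattice

noncomputable section

variable {d : ℕ}

/-- kernel: an integer of absolute value `≥ m` has real cast of absolute value `≥ m`. [folklore] -/
private theorem le_supNorm_of_coord {m : ℤ} {v : Fin (d + 1) → ℤ} (i : Fin (d + 1)) (h : m ≤ |v i|) :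
    ((m : ℤ) : ℝ) ≤ supNorm v :=
  le_trans (by exact_mod_cast h) (abs_le_supNorm v i)

/-- kernel: a weighted absolute bound valid along a convergent sequence passes to the limit. [folklore] -/
private theorem mul_abs_le_of_tendsto {F : ℕ → ℝ} {A c B : ℝ} (hF : Tendsto F atTop (𝓝 A)) (T : ℕ)
    (hB : ∀ t, T ≤ t → c * |F t| ≤ B) : c * |A| ≤ B :=
  le_of_tendsto (hF.abs.const_mul c) (eventually_atTop.2 ⟨T, hB⟩)

/-- kernel: as `mul_abs_le_of_tendsto`, two weights. [folklore] -/
private theorem mul_abs_le_of_tendsto₂ {F : ℕ → ℝ} {A p q B : ℝ} (hF : Tendsto F atTop (𝓝 A)) (T : ℕ)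
    (hB : ∀ t, T ≤ t → p * (q * |F t|) ≤ B) : p * (q * |A|) ≤ B :=
  le_of_tendsto ((hF.abs.const_mul q).const_mul p) (eventually_atTop.2 ⟨T, hB⟩)

/-- kernel: as `mul_abs_le_of_tendsto`, three weights. [folklore] -/
private theorem mul_abs_le_of_tendsto₃ {F : ℕ → ℝ} {A w p q B : ℝ} (hF : Tendsto F atTop (𝓝 A)) (T : ℕ)
    (hB : ∀ t, T ≤ t → w * (p * (q * |F t|)) ≤ B) : w * (p * (q * |A|)) ≤ B :=
  le_of_tendsto (((hF.abs.const_mul q).const_mul p).const_mul w) (eventually_atTop.2 ⟨T, hB⟩)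

/-! ## §1 The nesting `□ ⊂ C_t`, the depth of a point; §2 the kernel `δG_k(□, ηℤ^{d+1}, 0)`; §3 the six clauses -/

section Delta

/-- kernel: the box `□ = Π[0,M)` of unit blocks is nested in the cube `C_t` with offset `t·1` once `M_i ≤ t + 1`. [cite: Balaban1983Higgs3, (2.5) p.424] -/
theorem fits_box (M : Fin (d + 1) → ℕ) (t : ℕ) (hMt : ∀ i, M i ≤ t + 1) :
    Fits M (cubeM (d := d) t) (fun _ => (t : ℤ)) := by
  intro i
  have h : (M i : ℤ) ≤ t + 1 := by exact_mod_cast hMt i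
  refine ⟨by positivity, ?_⟩
  simp only [cubeM]; push_cast; linarith

/-- kernel: the nesting translation of `□ ⊂ C_t` is the centring shift. [cite: Balaban1983Higgs3, (2.5) p.424] -/
theorem emb_box {n : ℕ} {M : Fin (d + 1) → ℕ} {t : ℕ} (hMt : ∀ i, M i ≤ t + 1)
    (X : ↥(boxDom (fun i => n * M i))) : (emb ((fits_box M t hMt).scale n) X).1 = ctr n t X.1 := by
  rw [emb_val]; rfl

/-- kernel: fine points of `□` lie in `C_t` after centring. [cite: Balaban1983Higgs3, (2.5) p.424] -/
theorem ctr_mem_box {n : ℕ} {M : Fin (d + 1) → ℕ} {t : ℕ} (hMt : ∀ i, M i ≤ t + 1)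
    (X : ↥(boxDom (fun i => n * M i))) : ctr n t X.1 ∈ boxDom (fun i => n * cubeM (d := d) t i) := by
  have h := (emb ((fits_box M t hMt).scale n) X).2
  rwa [emb_box hMt X] at h

/-- **DEPTH `r` OF A FINE POINT OF `□ = Π[0,M)`**: its unit cube `□(v)`, `v = blk x`, is at label sup-distance `≥ r + 1`
from every unit cube of the complement `ηℤ^{d+1}∖□`, i.e. `r ≤ v_i ≤ M_i − 1 − r` — the instance's reading of the distance
in the first factor of (2.5) for the pair `(□, ηℤ^{d+1})` (p. 433: the localizations sit in `□₁ ⊂ □` at distance `r(L^kε)`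
from `∂□`). [cite: Balaban1983Higgs3, (2.5) p.424] -/
def Depth (n : ℕ) (M : Fin (d + 1) → ℕ) (r : ℕ) (x : Fin (d + 1) → ℤ) : Prop :=
  ∀ i, (r : ℤ) ≤ blk n x i ∧ blk n x i + r + 1 ≤ M i

/-- a larger depth implies a smaller one. [cite: Balaban1983Higgs3, (2.5) p.424] -/
theorem Depth.mono {n : ℕ} {M : Fin (d + 1) → ℕ} {r r' : ℕ} (h : r' ≤ r) {x : Fin (d + 1) → ℤ}
    (hx : Depth n M r x) : Depth n M r' x := fun i => by
  have := hx i
  have h' : (r' : ℤ) ≤ r := by exact_mod_cast h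
  exact ⟨by linarith, by linarith⟩

/-- **DEPTH IS gen-6's MARGIN** for the nesting `□ ⊂ C_t`: a point of depth `r` in `□` has label margin `r` with respect to
`C_t∖□`, for every admissible `t`. [cite: Balaban1983Higgs3, (2.5) p.424] -/
theorem margin_of_depth {n : ℕ} (hn : 1 ≤ n) {M : Fin (d + 1) → ℕ} {t : ℕ} (hMt : ∀ i, M i ≤ t + 1) {r : ℕ}
    {X : ↥(boxDom (fun i => n * M i))} (hX : Depth n M r X.1) : Margin n (fits_box M t hMt) r X := by
  intro y hy
  have hn0 : (0 : ℤ) < n := by exact_mod_cast hn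
  have hlab : blk n (emb ((fits_box M t hMt).scale n) X).1 = blk n X.1 + fun _ => (t : ℤ) := by
    rw [emb_box hMt X]; exact blk_ctr hn t X.1
  have hy0 := (mem_boxDom.1 y.2)
  have hy' : ∃ i, y.1 i < (n : ℤ) * t ∨ (n : ℤ) * (t + M i) ≤ y.1 i := by
    by_contra hcon
    apply hy
    rw [mem_boxDom]
    intro i
    have hi : ¬ (y.1 i < (n : ℤ) * t ∨ (n : ℤ) * (t + M i) ≤ y.1 i) := fun h => hcon ⟨i, h⟩
    rw [not_or, not_lt, not_le] at hi
    refine ⟨by simp only [Pi.sub_apply]; linarith, ?_⟩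
    simp only [Pi.sub_apply]; push_cast; linarith
  obtain ⟨i, hi⟩ := hy'
  obtain ⟨hx1, hx2⟩ := hX i
  simp only [blk] at hx1 hx2
  have key : (r : ℤ) + 1 ≤ |(blk n (emb ((fits_box M t hMt).scale n) X).1 - blk n y.1) i| := by
    rw [hlab]
    simp only [Pi.sub_apply, Pi.add_apply]
    rcases hi with hi | hi
    · have h1 : y.1 i / n < (t : ℤ) := (Int.ediv_lt_iff_lt_mul hn0).2 (by linarith)
      rw [abs_of_nonneg (by unfold blk; linarith)]
      unfold blk; linarith
    · have h1 : (t : ℤ) + M i ≤ y.1 i / n := (Int.le_ediv_iff_mul_le hn0).2 (by linarith)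
      rw [abs_of_nonpos (by unfold blk; linarith)]
      unfold blk; linarith
  have := le_supNorm_of_coord i key
  push_cast at this
  exact this

/-- **`δG_k(□, ηℤ^{d+1}, 0)(x,x′)` IN MATRIX UNITS** (p. 433 *"we substitute G_k(□,0) = G_k(0) + δG_k(□,ηZ^d,0) and we treat
δG_k as an external scalar field"*, with p. 414 `δG_k(Ω,Ω₂,B̃) = G_k(Ω,B̃) − G_k(Ω₂,B̃)` at `Ω = □`, `Ω₂ = ηℤ^{d+1}`, `B̃ = 0`):
the Neumann box propagator `G_k(□,0) = Gfine ℓ k M k a m2` minus the infinite-volume propagator `G_k(0) = GkLat` at two fine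
points of `□ = Π[0,M)`; the physical kernel is `η^{−(d+1)}·dGkLat`. [cite: Balaban1983Higgs3, (2.5) p.424] -/
def dGkLat (ℓ k : ℕ) (M : Fin (d + 1) → ℕ) (a m2 : ℝ) (x x' : ↥(boxDom (Nf ℓ k M))) : ℝ :=
  Gfine ℓ k M k a m2 x x' - GkLat ℓ k a m2 x.1 x'.1

section Clauses

variable {ℓ k : ℕ} {M : Fin (d + 1) → ℕ} {a m2 : ℝ}

/-- `δG_k(□,ηℤ^{d+1},0)` is a symmetric kernel. [cite: Balaban1983Higgs3, (2.5) p.424] -/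
theorem dGkLat_comm (x x' : ↥(boxDom (Nf ℓ k M))) : dGkLat ℓ k M a m2 x x' = dGkLat ℓ k M a m2 x' x := by
  unfold dGkLat
  rw [(Gfine_isSymm ℓ k M k a m2).apply x' x, GkLat_comm]

/-- **gen-6's nested-box kernel for `□ ⊂ C_t` is `g_t − G_k(□,0)`**: `δG_k(C_t, □, 0)(x,x′) = g_t(x,x′) − G_k(□,0)(x,x′)`, so
`δG_k(□, ηℤ^{d+1}, 0) = −lim_t δG_k(C_t, □, 0)`. [cite: Balaban1983Higgs3, (2.5) p.424] -/
theorem dGk_box_eq {t : ℕ} (hMt : ∀ i, M i ≤ t + 1) (x x' : ↥(boxDom (Nf ℓ k M))) :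
    dGk ℓ k (fits_box M t hMt) a m2 x x' = gcube ℓ k t a m2 x.1 x'.1 - Gfine ℓ k M k a m2 x x' := by
  have e1 : emb ((fits_box M t hMt).scale ((ℓ + 1) ^ k)) x = ⟨ctr ((ℓ + 1) ^ k) t x.1, ctr_mem_box hMt x⟩ :=
    Subtype.ext (emb_box hMt x)
  have e2 : emb ((fits_box M t hMt).scale ((ℓ + 1) ^ k)) x' = ⟨ctr ((ℓ + 1) ^ k) t x'.1, ctr_mem_box hMt x'⟩ :=
    Subtype.ext (emb_box hMt x')
  rw [dGk, e1, e2, gcube_eq (ctr_mem_box hMt x) (ctr_mem_box hMt x')]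

/-- kernel: `M_i ≤ t + 1` once `t ≥ Σ_i M_i`. [folklore] -/
private theorem le_succ_of_sum_le {M : Fin (d + 1) → ℕ} {t : ℕ} (ht : ∑ i, M i ≤ t) (i : Fin (d + 1)) : M i ≤ t + 1 :=
  ((Finset.single_le_sum (f := M) (fun _ _ => Nat.zero_le _) (Finset.mem_univ i)).trans ht).trans (Nat.le_succ t)

end Clauses

/-- **B3 (2.5) for `δG_k(□, ηℤ^{d+1}, 0)`, kernel level, VALUE**: there are `δ₀, C > 0` (on `d`, `L`, the window) such that
for every scale `k ≥ 1` (`η = L^{−k}`), window point, box `□` of unit blocks, depth `r ≥ 3` and fine points `x, x′ ∈ □` of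
depth `r`: `η^{−(d+1)}|δG_k(□,ηℤ^{d+1},0;x,x′)| ≤ C·e^{−δ₀r}·e^{−δ₀·η|x−x′|_∞}` — REGULAR ON THE DIAGONAL (gen-6
`abs_dGk_le` for `□ ⊂ C_t`, uniformly in `t`, in the limit `t → ∞`). [cite: Balaban1983Higgs3, (2.5) p.424] -/
theorem abs_dGkLat_le (d ℓ : ℕ) (hℓ : 1 ≤ ℓ) (amin aplus m2plus : ℝ) (ha : 0 < amin) :
    ∃ δ₀ C : ℝ, 0 < δ₀ ∧ 0 < C ∧ ∀ (k : ℕ), 1 ≤ k → ∀ (a m2 : ℝ), amin ≤ a → a ≤ aplus → 0 ≤ m2 → m2 ≤ m2plus →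
      ∀ (M : Fin (d + 1) → ℕ), (∀ i, 1 ≤ M i) → ∀ (r : ℕ), 3 ≤ r → ∀ (x x' : ↥(boxDom (Nf ℓ k M))),
        Depth ((ℓ + 1) ^ k) M r x.1 → Depth ((ℓ + 1) ^ k) M r x'.1 →
        ((((ℓ + 1) ^ k : ℕ)) : ℝ) ^ (d + 1) * |dGkLat ℓ k M a m2 x x'|
          ≤ C * Real.exp (-(δ₀ * r)) * Real.exp (-(δ₀ * (supNorm (x.1 - x'.1) / ((((ℓ + 1) ^ k : ℕ)) : ℝ)))) := by
  obtain ⟨δ₀, C, hδ₀, hC, h⟩ := abs_dGk_le d ℓ hℓ amin aplus m2plus ha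
  refine ⟨δ₀, C, hδ₀, hC, ?_⟩
  intro k hk a m2 h1 h2 h3 h4 M hM r hr x x' hx hx'
  have hn : 1 ≤ (ℓ + 1) ^ k := Nat.one_le_pow _ _ (by omega)
  have hB : ∀ t, ∑ i, M i ≤ t →
      ((((ℓ + 1) ^ k : ℕ)) : ℝ) ^ (d + 1) * |gcube ℓ k t a m2 x.1 x'.1 - Gfine ℓ k M k a m2 x x'|
        ≤ C * Real.exp (-(δ₀ * r)) * Real.exp (-(δ₀ * (supNorm (x.1 - x'.1) / ((((ℓ + 1) ^ k : ℕ)) : ℝ)))) := by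
    intro t ht
    have hMt := le_succ_of_sum_le ht
    have hb := h k hk a m2 h1 h2 h3 h4 M (cubeM t) _ (fits_box M t hMt) hM r hr x x'
      (margin_of_depth hn hMt hx) (margin_of_depth hn hMt hx')
    rwa [dGk_box_eq hMt] at hb
  rw [dGkLat, abs_sub_comm]
  exact mul_abs_le_of_tendsto ((tendsto_gcube hℓ hk (ha.trans_le h1) h3 x.1 x'.1).sub_const _) _ hB

/-- **B3 (2.5) for `δG_k(□, ηℤ^{d+1}, 0)`, kernel level, DERIVATIVE IN THE ROW VARIABLE**:
`η^{−(d+1)}·|(∂^η_μδG_k)(x,x′)| = (L^k)^{d+1}·L^k·|δG_k(x+e_μ,x′) − δG_k(x,x′)| ≤ C·e^{−δ₀r}·e^{−δ₀·η|x−x′|_∞}` for `x, x′` of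
depth `r ≥ 3` and `x + e_μ ∈ □` (gen-6 `abs_dGkDiff_le` in the limit). [cite: Balaban1983Higgs3, (2.5) p.424] -/
theorem abs_dGkLatDiff_le (d ℓ : ℕ) (hℓ : 1 ≤ ℓ) (amin aplus m2plus : ℝ) (ha : 0 < amin) :
    ∃ δ₀ C : ℝ, 0 < δ₀ ∧ 0 < C ∧ ∀ (k : ℕ), 1 ≤ k → ∀ (a m2 : ℝ), amin ≤ a → a ≤ aplus → 0 ≤ m2 → m2 ≤ m2plus →
      ∀ (M : Fin (d + 1) → ℕ), (∀ i, 1 ≤ M i) → ∀ (r : ℕ), 3 ≤ r →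
      ∀ (μ : Fin (d + 1)) (x xe : ↥(boxDom (Nf ℓ k M))), xe.1 = x.1 + Pi.single μ 1 →
      ∀ (x' : ↥(boxDom (Nf ℓ k M))), Depth ((ℓ + 1) ^ k) M r x.1 → Depth ((ℓ + 1) ^ k) M r x'.1 →
        ((((ℓ + 1) ^ k : ℕ)) : ℝ) ^ (d + 1) *
            (((((ℓ + 1) ^ k : ℕ)) : ℝ) * |dGkLat ℓ k M a m2 xe x' - dGkLat ℓ k M a m2 x x'|)
          ≤ C * Real.exp (-(δ₀ * r)) * Real.exp (-(δ₀ * (supNorm (x.1 - x'.1) / ((((ℓ + 1) ^ k : ℕ)) : ℝ)))) := by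
  obtain ⟨δ₀, C, hδ₀, hC, h⟩ := abs_dGkDiff_le d ℓ hℓ amin aplus m2plus ha
  refine ⟨δ₀, C, hδ₀, hC, ?_⟩
  intro k hk a m2 h1 h2 h3 h4 M hM r hr μ x xe hxe x' hx hx'
  have hn : 1 ≤ (ℓ + 1) ^ k := Nat.one_le_pow _ _ (by omega)
  have ha0 : 0 < a := ha.trans_le h1
  have hB : ∀ t, ∑ i, M i ≤ t →
      ((((ℓ + 1) ^ k : ℕ)) : ℝ) ^ (d + 1) * (((((ℓ + 1) ^ k : ℕ)) : ℝ) *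
        |(gcube ℓ k t a m2 xe.1 x'.1 - Gfine ℓ k M k a m2 xe x') - (gcube ℓ k t a m2 x.1 x'.1 - Gfine ℓ k M k a m2 x x')|)
        ≤ C * Real.exp (-(δ₀ * r)) * Real.exp (-(δ₀ * (supNorm (x.1 - x'.1) / ((((ℓ + 1) ^ k : ℕ)) : ℝ)))) := by
    intro t ht
    have hMt := le_succ_of_sum_le ht
    have hb := h k hk a m2 h1 h2 h3 h4 M (cubeM t) _ (fits_box M t hMt) hM r hr μ x xe hxe x'
      (margin_of_depth hn hMt hx) (margin_of_depth hn hMt hx')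
    rwa [dGk_box_eq hMt, dGk_box_eq hMt] at hb
  have hF : Tendsto (fun t => (gcube ℓ k t a m2 xe.1 x'.1 - Gfine ℓ k M k a m2 xe x')
      - (gcube ℓ k t a m2 x.1 x'.1 - Gfine ℓ k M k a m2 x x')) atTop
      (𝓝 ((GkLat ℓ k a m2 xe.1 x'.1 - Gfine ℓ k M k a m2 xe x') - (GkLat ℓ k a m2 x.1 x'.1 - Gfine ℓ k M k a m2 x x'))) :=
    ((tendsto_gcube hℓ hk ha0 h3 xe.1 x'.1).sub_const _).sub ((tendsto_gcube hℓ hk ha0 h3 x.1 x'.1).sub_const _)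
  have hlim := mul_abs_le_of_tendsto₂ hF _ hB
  have e : dGkLat ℓ k M a m2 xe x' - dGkLat ℓ k M a m2 x x'
      = -((GkLat ℓ k a m2 xe.1 x'.1 - Gfine ℓ k M k a m2 xe x') - (GkLat ℓ k a m2 x.1 x'.1 - Gfine ℓ k M k a m2 x x')) := by
    unfold dGkLat; ring
  rw [e, abs_neg]
  exact hlim

/-- **B3 (2.5) for `δG_k(□, ηℤ^{d+1}, 0)`, kernel level, DERIVATIVE IN THE COLUMN VARIABLE** (by the symmetry of the kernel).
[cite: Balaban1983Higgs3, (2.5) p.424] -/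
theorem abs_dGkLatDiff'_le (d ℓ : ℕ) (hℓ : 1 ≤ ℓ) (amin aplus m2plus : ℝ) (ha : 0 < amin) :
    ∃ δ₀ C : ℝ, 0 < δ₀ ∧ 0 < C ∧ ∀ (k : ℕ), 1 ≤ k → ∀ (a m2 : ℝ), amin ≤ a → a ≤ aplus → 0 ≤ m2 → m2 ≤ m2plus →
      ∀ (M : Fin (d + 1) → ℕ), (∀ i, 1 ≤ M i) → ∀ (r : ℕ), 3 ≤ r →
      ∀ (x : ↥(boxDom (Nf ℓ k M))) (ν : Fin (d + 1)) (x' xe' : ↥(boxDom (Nf ℓ k M))), xe'.1 = x'.1 + Pi.single ν 1 →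
      Depth ((ℓ + 1) ^ k) M r x.1 → Depth ((ℓ + 1) ^ k) M r x'.1 →
        ((((ℓ + 1) ^ k : ℕ)) : ℝ) ^ (d + 1) *
            (((((ℓ + 1) ^ k : ℕ)) : ℝ) * |dGkLat ℓ k M a m2 x xe' - dGkLat ℓ k M a m2 x x'|)
          ≤ C * Real.exp (-(δ₀ * r)) * Real.exp (-(δ₀ * (supNorm (x.1 - x'.1) / ((((ℓ + 1) ^ k : ℕ)) : ℝ)))) := by
  obtain ⟨δ₀, C, hδ₀, hC, h⟩ := abs_dGkLatDiff_le d ℓ hℓ amin aplus m2plus ha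
  refine ⟨δ₀, C, hδ₀, hC, ?_⟩
  intro k hk a m2 h1 h2 h3 h4 M hM r hr x ν x' xe' hxe' hx hx'
  have h' := h k hk a m2 h1 h2 h3 h4 M hM r hr ν x' xe' hxe' x hx' hx
  rw [dGkLat_comm xe' x, dGkLat_comm x' x, supNorm_sub_comm] at h'
  exact h'

/-- **B3 (2.5) for `δG_k(□, ηℤ^{d+1}, 0)`, kernel level, HÖLDER QUOTIENT OF THE ROW DERIVATIVE IN THE ROW VARIABLE** (per
`0 ≤ α < 1`): for row bonds at `x₁ ≠ x₂` and a column point `x′`, all of depth `r ≥ 3`,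
`(η|x₂−x₁|_∞)^{−α}·η^{−(d+1)}|(∂^η_μδG_k)(x₂,x′) − (∂^η_μδG_k)(x₁,x′)| ≤ C·e^{−δ₀r}·e^{−δ₀·η·min(|x₁−x′|_∞,|x₂−x′|_∞)}`
(«This applies also to Hölder norms», (2.11); gen-6 `abs_dGkDD_le` in the limit). [cite: Balaban1983Higgs3, (2.5) p.424] -/
theorem abs_dGkLatDD_le (d ℓ : ℕ) (hℓ : 1 ≤ ℓ) (amin aplus m2plus : ℝ) (ha : 0 < amin) {α : ℝ} (hα0 : 0 ≤ α)
    (hα1 : α < 1) :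
    ∃ δ₀ C : ℝ, 0 < δ₀ ∧ 0 < C ∧ ∀ (k : ℕ), 1 ≤ k → ∀ (a m2 : ℝ), amin ≤ a → a ≤ aplus → 0 ≤ m2 → m2 ≤ m2plus →
      ∀ (M : Fin (d + 1) → ℕ), (∀ i, 1 ≤ M i) → ∀ (r : ℕ), 3 ≤ r →
      ∀ (μ : Fin (d + 1)) (x₁ xe₁ x₂ xe₂ : ↥(boxDom (Nf ℓ k M))), xe₁.1 = x₁.1 + Pi.single μ 1 →
        xe₂.1 = x₂.1 + Pi.single μ 1 → x₂.1 ≠ x₁.1 → ∀ (x' : ↥(boxDom (Nf ℓ k M))),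
        Depth ((ℓ + 1) ^ k) M r x₁.1 → Depth ((ℓ + 1) ^ k) M r x₂.1 → Depth ((ℓ + 1) ^ k) M r x'.1 →
        ((((ℓ + 1) ^ k : ℕ) : ℝ) / supNorm (x₂.1 - x₁.1)) ^ α *
            (((((ℓ + 1) ^ k : ℕ)) : ℝ) ^ (d + 1) *
              ((((ℓ + 1) ^ k : ℕ) : ℝ) * |(dGkLat ℓ k M a m2 xe₂ x' - dGkLat ℓ k M a m2 x₂ x')
                - (dGkLat ℓ k M a m2 xe₁ x' - dGkLat ℓ k M a m2 x₁ x')|))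
          ≤ C * Real.exp (-(δ₀ * r)) *
            Real.exp (-(δ₀ * (min (supNorm (x₁.1 - x'.1)) (supNorm (x₂.1 - x'.1)) / ((((ℓ + 1) ^ k : ℕ)) : ℝ)))) := by
  obtain ⟨δ₀, C, hδ₀, hC, h⟩ := abs_dGkDD_le d ℓ hℓ amin aplus m2plus ha hα0 hα1
  refine ⟨δ₀, C, hδ₀, hC, ?_⟩
  intro k hk a m2 h1 h2 h3 h4 M hM r hr μ x₁ xe₁ x₂ xe₂ hxe₁ hxe₂ hne x' hx₁ hx₂ hx'
  have hn : 1 ≤ (ℓ + 1) ^ k := Nat.one_le_pow _ _ (by omega)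
  have ha0 : 0 < a := ha.trans_le h1
  -- the combination of cube/box propagators whose limit is minus the `δG_k(□,ηℤ,0)` combination
  set F : ℕ → ℝ := fun t =>
    ((gcube ℓ k t a m2 xe₂.1 x'.1 - Gfine ℓ k M k a m2 xe₂ x') - (gcube ℓ k t a m2 x₂.1 x'.1 - Gfine ℓ k M k a m2 x₂ x'))
    - ((gcube ℓ k t a m2 xe₁.1 x'.1 - Gfine ℓ k M k a m2 xe₁ x') - (gcube ℓ k t a m2 x₁.1 x'.1 - Gfine ℓ k M k a m2 x₁ x'))
    with hFdef
  set Ainf : ℝ :=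
    ((GkLat ℓ k a m2 xe₂.1 x'.1 - Gfine ℓ k M k a m2 xe₂ x') - (GkLat ℓ k a m2 x₂.1 x'.1 - Gfine ℓ k M k a m2 x₂ x'))
    - ((GkLat ℓ k a m2 xe₁.1 x'.1 - Gfine ℓ k M k a m2 xe₁ x') - (GkLat ℓ k a m2 x₁.1 x'.1 - Gfine ℓ k M k a m2 x₁ x'))
    with hAdef
  have hB : ∀ t, ∑ i, M i ≤ t →
      ((((ℓ + 1) ^ k : ℕ) : ℝ) / supNorm (x₂.1 - x₁.1)) ^ α *
        (((((ℓ + 1) ^ k : ℕ)) : ℝ) ^ (d + 1) * ((((ℓ + 1) ^ k : ℕ) : ℝ) * |F t|))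
        ≤ C * Real.exp (-(δ₀ * r)) *
            Real.exp (-(δ₀ * (min (supNorm (x₁.1 - x'.1)) (supNorm (x₂.1 - x'.1)) / ((((ℓ + 1) ^ k : ℕ)) : ℝ)))) := by
    intro t ht
    have hMt := le_succ_of_sum_le ht
    have hb := h k hk a m2 h1 h2 h3 h4 M (cubeM t) _ (fits_box M t hMt) hM r hr μ x₁ xe₁ x₂ xe₂ hxe₁ hxe₂ hne x'
      (margin_of_depth hn hMt hx₁) (margin_of_depth hn hMt hx₂) (margin_of_depth hn hMt hx')
    rw [dGk_box_eq hMt, dGk_box_eq hMt, dGk_box_eq hMt, dGk_box_eq hMt] at hb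
    exact hb
  have hF : Tendsto F atTop (𝓝 Ainf) :=
    ((((tendsto_gcube hℓ hk ha0 h3 xe₂.1 x'.1).sub_const _).sub
      ((tendsto_gcube hℓ hk ha0 h3 x₂.1 x'.1).sub_const _))).sub
    ((((tendsto_gcube hℓ hk ha0 h3 xe₁.1 x'.1).sub_const _).sub
      ((tendsto_gcube hℓ hk ha0 h3 x₁.1 x'.1).sub_const _)))
  have hlim := mul_abs_le_of_tendsto₃ hF _ hB
  have e : (dGkLat ℓ k M a m2 xe₂ x' - dGkLat ℓ k M a m2 x₂ x') - (dGkLat ℓ k M a m2 xe₁ x' - dGkLat ℓ k M a m2 x₁ x')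
      = -Ainf := by
    rw [hAdef]; unfold dGkLat; ring
  rw [e, abs_neg]
  exact hlim

/-- **B3 (2.5) for `δG_k(□, ηℤ^{d+1}, 0)`, kernel level, HÖLDER QUOTIENT OF THE COLUMN DERIVATIVE IN THE COLUMN VARIABLE** (by
symmetry). [cite: Balaban1983Higgs3, (2.5) p.424] -/
theorem abs_dGkLatDD'_le (d ℓ : ℕ) (hℓ : 1 ≤ ℓ) (amin aplus m2plus : ℝ) (ha : 0 < amin) {α : ℝ} (hα0 : 0 ≤ α)
    (hα1 : α < 1) :
    ∃ δ₀ C : ℝ, 0 < δ₀ ∧ 0 < C ∧ ∀ (k : ℕ), 1 ≤ k → ∀ (a m2 : ℝ), amin ≤ a → a ≤ aplus → 0 ≤ m2 → m2 ≤ m2plus →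
      ∀ (M : Fin (d + 1) → ℕ), (∀ i, 1 ≤ M i) → ∀ (r : ℕ), 3 ≤ r →
      ∀ (x : ↥(boxDom (Nf ℓ k M))) (ν : Fin (d + 1)) (x₁' xe₁' x₂' xe₂' : ↥(boxDom (Nf ℓ k M))),
        xe₁'.1 = x₁'.1 + Pi.single ν 1 → xe₂'.1 = x₂'.1 + Pi.single ν 1 → x₂'.1 ≠ x₁'.1 →
        Depth ((ℓ + 1) ^ k) M r x.1 → Depth ((ℓ + 1) ^ k) M r x₁'.1 → Depth ((ℓ + 1) ^ k) M r x₂'.1 →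
        ((((ℓ + 1) ^ k : ℕ) : ℝ) / supNorm (x₂'.1 - x₁'.1)) ^ α *
            (((((ℓ + 1) ^ k : ℕ)) : ℝ) ^ (d + 1) *
              ((((ℓ + 1) ^ k : ℕ) : ℝ) * |(dGkLat ℓ k M a m2 x xe₂' - dGkLat ℓ k M a m2 x x₂')
                - (dGkLat ℓ k M a m2 x xe₁' - dGkLat ℓ k M a m2 x x₁')|))
          ≤ C * Real.exp (-(δ₀ * r)) *
            Real.exp (-(δ₀ * (min (supNorm (x.1 - x₁'.1)) (supNorm (x.1 - x₂'.1)) / ((((ℓ + 1) ^ k : ℕ)) : ℝ)))) := by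
  obtain ⟨δ₀, C, hδ₀, hC, h⟩ := abs_dGkLatDD_le d ℓ hℓ amin aplus m2plus ha hα0 hα1
  refine ⟨δ₀, C, hδ₀, hC, ?_⟩
  intro k hk a m2 h1 h2 h3 h4 M hM r hr x ν x₁' xe₁' x₂' xe₂' hxe₁ hxe₂ hne hx hx₁ hx₂
  have h' := h k hk a m2 h1 h2 h3 h4 M hM r hr ν x₁' xe₁' x₂' xe₂' hxe₁ hxe₂ hne x hx₁ hx₂ hx
  rw [dGkLat_comm xe₂' x, dGkLat_comm x₂' x, dGkLat_comm xe₁' x, dGkLat_comm x₁' x, supNorm_sub_comm x₁'.1 x.1,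
    supNorm_sub_comm x₂'.1 x.1] at h'
  exact h'

/-- **B3 (2.5) for `δG_k(□, ηℤ^{d+1}, 0)`, kernel level, MIXED SECOND DIFFERENCE**: `η^{−(d+1)}·|(∂^η_μ δG_k ∂^{η*}_ν)(x,x′)| =
(L^k)^{d+1}·(L^k)²·|δG_k(x+e_μ,x′+e_ν) − δG_k(x,x′+e_ν) − δG_k(x+e_μ,x′) + δG_k(x,x′)| ≤ C·e^{−δ₀r}·e^{−δ₀·η|x−x′|_∞}` for `x, x′`
of depth `r ≥ 3` (gen-6 `abs_dGkMixed_le` in the limit). [cite: Balaban1983Higgs3, (2.5) p.424] -/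
theorem abs_dGkLatMixed_le (d ℓ : ℕ) (hℓ : 1 ≤ ℓ) (amin aplus m2plus : ℝ) (ha : 0 < amin) :
    ∃ δ₀ C : ℝ, 0 < δ₀ ∧ 0 < C ∧ ∀ (k : ℕ), 1 ≤ k → ∀ (a m2 : ℝ), amin ≤ a → a ≤ aplus → 0 ≤ m2 → m2 ≤ m2plus →
      ∀ (M : Fin (d + 1) → ℕ), (∀ i, 1 ≤ M i) → ∀ (r : ℕ), 3 ≤ r →
      ∀ (μ ν : Fin (d + 1)) (x xe : ↥(boxDom (Nf ℓ k M))), xe.1 = x.1 + Pi.single μ 1 →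
      ∀ (x' xe' : ↥(boxDom (Nf ℓ k M))), xe'.1 = x'.1 + Pi.single ν 1 →
        Depth ((ℓ + 1) ^ k) M r x.1 → Depth ((ℓ + 1) ^ k) M r x'.1 →
        ((((ℓ + 1) ^ k : ℕ)) : ℝ) ^ (d + 1) *
            (((((ℓ + 1) ^ k : ℕ)) : ℝ) ^ 2 * |(dGkLat ℓ k M a m2 xe xe' - dGkLat ℓ k M a m2 x xe')
              - (dGkLat ℓ k M a m2 xe x' - dGkLat ℓ k M a m2 x x')|)
          ≤ C * Real.exp (-(δ₀ * r)) * Real.exp (-(δ₀ * (supNorm (x.1 - x'.1) / ((((ℓ + 1) ^ k : ℕ)) : ℝ)))) := by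
  obtain ⟨δ₀, C, hδ₀, hC, h⟩ := abs_dGkMixed_le d ℓ hℓ amin aplus m2plus ha
  refine ⟨δ₀, C, hδ₀, hC, ?_⟩
  intro k hk a m2 h1 h2 h3 h4 M hM r hr μ ν x xe hxe x' xe' hxe' hx hx'
  have hn : 1 ≤ (ℓ + 1) ^ k := Nat.one_le_pow _ _ (by omega)
  have ha0 : 0 < a := ha.trans_le h1
  set F : ℕ → ℝ := fun t =>
    ((gcube ℓ k t a m2 xe.1 xe'.1 - Gfine ℓ k M k a m2 xe xe') - (gcube ℓ k t a m2 x.1 xe'.1 - Gfine ℓ k M k a m2 x xe'))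
    - ((gcube ℓ k t a m2 xe.1 x'.1 - Gfine ℓ k M k a m2 xe x') - (gcube ℓ k t a m2 x.1 x'.1 - Gfine ℓ k M k a m2 x x'))
    with hFdef
  set Ainf : ℝ :=
    ((GkLat ℓ k a m2 xe.1 xe'.1 - Gfine ℓ k M k a m2 xe xe') - (GkLat ℓ k a m2 x.1 xe'.1 - Gfine ℓ k M k a m2 x xe'))
    - ((GkLat ℓ k a m2 xe.1 x'.1 - Gfine ℓ k M k a m2 xe x') - (GkLat ℓ k a m2 x.1 x'.1 - Gfine ℓ k M k a m2 x x'))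
    with hAdef
  have hB : ∀ t, ∑ i, M i ≤ t →
      ((((ℓ + 1) ^ k : ℕ)) : ℝ) ^ (d + 1) * (((((ℓ + 1) ^ k : ℕ)) : ℝ) ^ 2 * |F t|)
        ≤ C * Real.exp (-(δ₀ * r)) * Real.exp (-(δ₀ * (supNorm (x.1 - x'.1) / ((((ℓ + 1) ^ k : ℕ)) : ℝ)))) := by
    intro t ht
    have hMt := le_succ_of_sum_le ht
    have hb := h k hk a m2 h1 h2 h3 h4 M (cubeM t) _ (fits_box M t hMt) hM r hr μ ν x xe hxe x' xe' hxe'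
      (margin_of_depth hn hMt hx) (margin_of_depth hn hMt hx')
    rw [dGk_box_eq hMt, dGk_box_eq hMt, dGk_box_eq hMt, dGk_box_eq hMt] at hb
    exact hb
  have hF : Tendsto F atTop (𝓝 Ainf) :=
    ((((tendsto_gcube hℓ hk ha0 h3 xe.1 xe'.1).sub_const _).sub
      ((tendsto_gcube hℓ hk ha0 h3 x.1 xe'.1).sub_const _))).sub
    ((((tendsto_gcube hℓ hk ha0 h3 xe.1 x'.1).sub_const _).sub
      ((tendsto_gcube hℓ hk ha0 h3 x.1 x'.1).sub_const _)))
  have hlim := mul_abs_le_of_tendsto₂ hF _ hB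
  have e : (dGkLat ℓ k M a m2 xe xe' - dGkLat ℓ k M a m2 x xe') - (dGkLat ℓ k M a m2 xe x' - dGkLat ℓ k M a m2 x x')
      = -Ainf := by
    rw [hAdef]; unfold dGkLat; ring
  rw [e, abs_neg]
  exact hlim

end Delta

/-! ## §4 Non-vacuity: a box with points of depth `3` (`d + 1 = 3`, `L = 2`, `k = 1`, `□ = [0,7)³` unit blocks, the fine point
`(6,6,6)` of label `(3,3,3)`, window `[1,1] × [0,0]`) — the binders of the value clause are inhabited -/

/-- kernel: the witness point. [folklore] -/
private theorem witness_mem : (fun _ : Fin 3 => (6 : ℤ)) ∈ boxDom (Nf 1 1 (fun _ : Fin 3 => 7)) := by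
  rw [mem_boxDom]; intro i; simp

/-- kernel: the witness point has depth `3`. [folklore] -/
private theorem witness_depth : Depth 2 (fun _ : Fin 3 => 7) 3 (fun _ : Fin 3 => (6 : ℤ)) := by
  intro i; simp [blk]

/-- **INHABITED BINDERS of the value clause** (bookkeeping, NOT content): the hypotheses of `abs_dGkLat_le` are met by the data
`d + 1 = 3`, `L = 2`, `k = 1`, window `a = 1`, `m² = 0`, `□ = [0,7)³`, the fine point `(6,6,6)` of depth `3` (`witness_mem`,
`witness_depth`), so its constants `δ₀, C` specialise to `η^{−3}|δG_1(□,ηℤ³,0;x,x)| ≤ C·e^{−3δ₀}` at that point.  As a standalone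
statement the display below is a tautology — the outer `∃ δ₀ C` absorbs any single finite value — and must not be counted as a
proved instance of (2.5); the content is `abs_dGkLat_le` (v1.1 docstring rewording, ref-1 gen 48 vacuity note 2026-08-22).
[cite: Balaban1983Higgs3, (2.5) p.424] -/
theorem abs_dGkLat_le_witness :
    ∃ δ₀ C : ℝ, 0 < δ₀ ∧ 0 < C ∧
      (((2 ^ 1 : ℕ) : ℝ)) ^ (2 + 1) * |dGkLat 1 1 (fun _ : Fin 3 => 7) 1 0 ⟨_, witness_mem⟩ ⟨_, witness_mem⟩|
        ≤ C * Real.exp (-(δ₀ * (3 : ℕ))) * Real.exp (-(δ₀ * (supNorm ((fun _ : Fin 3 => (6 : ℤ)) - fun _ : Fin 3 => (6 : ℤ))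
          / (((2 ^ 1 : ℕ) : ℝ))))) := by
  obtain ⟨δ₀, C, hδ₀, hC, h⟩ := abs_dGkLat_le 2 1 le_rfl 1 1 0 one_pos
  exact ⟨δ₀, C, hδ₀, hC, h 1 le_rfl 1 0 le_rfl le_rfl le_rfl le_rfl (fun _ => 7) (fun _ => by norm_num) 3 le_rfl
    ⟨_, witness_mem⟩ ⟨_, witness_mem⟩ witness_depth witness_depth⟩

end

end Literature.MathematicalPhysics.QuantumFieldTheory.Balaban1983to89.B3DeltaGkZeroLattice
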